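import Mathlib.RingTheory.DedekindDomain.Dvr
import Mathlib.RingTheory.DedekindDomain.Factorization
import Mathlib.RingTheory.Localization.Ideal
import Mathlib.RingTheory.Localization.LocalizationLocalization
import Mathlib.RingTheory.Localization.Away.Basic
import Mathlib.RingTheory.Ideal.Quotient.Operations
import HarnessLib

/-!
# [AbsTopIII] Rmk. 1.5.4 (i), "restricting to closed points": the closed points of `Spec R[1/f]`

Proof-only, Mathlib-only companion to the route of record for the last open part of the abc-iut cell's
FACT-LIST row F-0369 (`Rmk_1_5_4_i`, "sub-`p`-adic ⟹ Kummer-faithful", S. Mochizuki, *Topics in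
Absolute Anabelian Geometry III*, §1, Rmk. 1.5.4 (i) p. 33: "by restricting to various closed points of
this variety, one reduces to the case where `k` itself is an MLF"; route memo
`HOME/staging/f/f-083/g2/F0369-FG-ROUTE.md`, junction J-a′).

The spreading-out step of the route (`Literature.NumberTheory.EllipticCurves.exists_abelianScheme_away`)
produces an abelian scheme over a ring `R'` with `IsLocalization.Away f R'` (`R' = R[1/f]`, `0 ≠ f ∈ R`,
`R` the Dedekind model of junction J-a).  The closed-point induction then needs, for such an ABSTRACT
localisation `R'`:

* `IsLocalization.Away.isDomain'`, `IsLocalization.Away.isDedekindDomain` — `R'` is a Dedekind domain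
  (Mathlib `IsLocalization.isDedekindDomain`);
* `IsLocalization.Away.isFractionRing` — `Frac R' = Frac R` (Mathlib);
* `IsLocalization.Away.isMaximal_map`, `comap_map_eq`, `bijective_quotientMap_map` — a maximal ideal
  `𝔪 ∌ f` of `R` extends to a maximal ideal `𝔪 R'` of `R'` with `𝔪 R' ∩ R = 𝔪` and `R/𝔪 ≅ R'/𝔪R'`;
* `IsLocalization.Away.finite_setOf_isMaximal_mem`, `infinite_setOf_isMaximal_not_mem`,
  `infinite_setOf_isMaximal` — only finitely many maximal ideals contain `f`, so if `R` has infinitely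
  many maximal ideals then so has `R'` ("various closed points" survive the removal of `V(f)`);
* `IsLocalization.Away.ne_bot_of_isMaximal`, `isMaximal_comap`, `bijective_quotientMap` — conversely
  (when `R` has infinitely many maximal ideals, so that `R'` is not a field) every maximal ideal `𝔪'`
  of `R'` contracts to a maximal ideal of `R` with the SAME residue field;
* `IsLocalization.Away.moduleFinite_quotient` — hence the residue fields of `R'` are finite over any
  base `F` over which those of `R` are (with J-a: finite over `F = ℚ_p(t₁,…,t_{d-1})`, resp. `p`-adic
  fields for `d = 1`).

Classical commutative algebra (Atiyah–Macdonald Prop. 3.11; Neukirch I §3, §11); nothing here bears on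
[IUTchIII] Cor. 3.12; typed ≠ discharged.
-/

noncomputable section

open scoped Classical

namespace Literature.AnabelianGeometry.AbsoluteAnabelian.AbsTopIII

namespace IsLocalization.Away

universe u v w

variable {R : Type u} [CommRing R] [IsDedekindDomain R] {f : R}
  (R' : Type v) [CommRing R'] [Algebra R R'] [IsLocalization.Away f R']

/-! ### `R[1/f]` is a Dedekind domain with the same fraction field -/

/-- For `f ≠ 0` in a domain, the powers of `f` are non-zero-divisors.
[cite: AtiyahMacdonald1969, Ch. 3 Prop. 3.11 (iv)] -/
theorem powers_le_nonZeroDivisors (hf : f ≠ 0) : Submonoid.powers f ≤ nonZeroDivisors R :=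
  powers_le_nonZeroDivisors_of_noZeroDivisors hf

/-- `R[1/f]` (`f ≠ 0`) is a domain. [cite: AtiyahMacdonald1969, Ch. 3 Prop. 3.11 (iv)] -/
theorem isDomain' (hf : f ≠ 0) : IsDomain R' :=
  IsLocalization.isDomain_of_le_nonZeroDivisors R' (powers_le_nonZeroDivisors hf)

/-- The structure map `R → R[1/f]` (`f ≠ 0`) is injective.
[cite: AtiyahMacdonald1969, Ch. 3 Prop. 3.11 (iv)] -/
theorem algebraMap_injective (hf : f ≠ 0) : Function.Injective (algebraMap R R') :=
  IsLocalization.injective R' (powers_le_nonZeroDivisors hf)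

/-- **`R[1/f]` is a Dedekind domain** (`R` Dedekind, `f ≠ 0`): Mathlib's
`IsLocalization.isDedekindDomain` for the submonoid of powers of `f`.
[cite: NeukirchANT1999, Ch. I §11 Prop. (11.4)] -/
theorem isDedekindDomain (hf : f ≠ 0) : IsDedekindDomain R' := by
  haveI := isDomain' R' hf
  exact IsLocalization.isDedekindDomain R (powers_le_nonZeroDivisors hf) R'

include f in
/-- **`R[1/f]` has the same fraction field as `R`**: if `K = Frac R` and `R → R[1/f] → K` commute,
then `K = Frac R[1/f]`. [cite: AtiyahMacdonald1969, Ch. 3 Prop. 3.11 (iv)] -/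
theorem isFractionRing (K : Type w) [CommRing K] [Algebra R K] [IsFractionRing R K]
    [Algebra R' K] [IsScalarTower R R' K] : IsFractionRing R' K :=
  IsFractionRing.isFractionRing_of_isDomain_of_isLocalization (Submonoid.powers f) R' K

/-! ### Maximal ideals of `R` not containing `f` extend to maximal ideals of `R[1/f]` -/

omit [IsDedekindDomain R] in
/-- A prime ideal not containing `f` is disjoint from the powers of `f`.
[cite: AtiyahMacdonald1969, Ch. 3 Prop. 3.11 (iv)] -/
theorem disjoint_powers_of_not_mem {𝔭 : Ideal R} [h𝔭 : 𝔭.IsPrime] (hfp : f ∉ 𝔭) :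
    Disjoint (Submonoid.powers f : Set R) 𝔭 := by
  rw [Set.disjoint_left]
  rintro x ⟨n, rfl⟩ hx
  exact hfp (h𝔭.mem_of_pow_mem n hx)

omit [IsDedekindDomain R] in
/-- For a prime `𝔭 ∌ f` of `R`, the extension `𝔭 R[1/f]` is prime.
[cite: AtiyahMacdonald1969, Ch. 3 Prop. 3.11 (iv)] -/
theorem isPrime_map {𝔭 : Ideal R} [h𝔭 : 𝔭.IsPrime] (hfp : f ∉ 𝔭) :
    (𝔭.map (algebraMap R R')).IsPrime :=
  IsLocalization.isPrime_of_isPrime_disjoint (Submonoid.powers f) R' 𝔭 h𝔭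
    (disjoint_powers_of_not_mem hfp)

omit [IsDedekindDomain R] in
/-- For a prime `𝔭 ∌ f` of `R`, `𝔭 R[1/f] ∩ R = 𝔭`. [cite: AtiyahMacdonald1969, Ch. 3 Prop. 3.11 (iv)] -/
theorem comap_map_eq {𝔭 : Ideal R} [h𝔭 : 𝔭.IsPrime] (hfp : f ∉ 𝔭) :
    (𝔭.map (algebraMap R R')).comap (algebraMap R R') = 𝔭 :=
  IsLocalization.under_map_of_isPrime_disjoint (Submonoid.powers f) R' h𝔭
    (disjoint_powers_of_not_mem hfp)

omit [IsDedekindDomain R] in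
/-- For a MAXIMAL ideal `𝔪 ∌ f` of `R`, the residue map `R/𝔪 → R[1/f]/𝔪R[1/f]` is bijective
(injective because `𝔪 R[1/f] ∩ R = 𝔪`; surjective because `R/𝔪` is a field, so the inverse of `f`
is already there — Mathlib `IsLocalization.surjective_quotientMap_of_maximal_of_localization`).
[cite: AtiyahMacdonald1969, Ch. 3 Prop. 3.11 (iv)] -/
theorem bijective_quotientMap_map {𝔪 : Ideal R} [h𝔪 : 𝔪.IsMaximal] (hfm : f ∉ 𝔪) :
    Function.Bijective
      (Ideal.quotientMap (𝔪.map (algebraMap R R')) (algebraMap R R') Ideal.le_comap_map :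
        R ⧸ 𝔪 →+* R' ⧸ 𝔪.map (algebraMap R R')) := by
  haveI : (𝔪.map (algebraMap R R')).IsPrime := isPrime_map R' hfm
  have hcomap : (𝔪.map (algebraMap R R')).comap (algebraMap R R') = 𝔪 := comap_map_eq R' hfm
  refine ⟨Ideal.quotientMap_injective' (le_of_eq hcomap), ?_⟩
  have hI : ((𝔪.map (algebraMap R R')).under R).IsMaximal := by
    change ((𝔪.map (algebraMap R R')).comap (algebraMap R R')).IsMaximal
    rw [hcomap]
    exact h𝔪
  exact IsLocalization.surjective_quotientMap_of_maximal_of_localization (Submonoid.powers f) R'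
    (H := Ideal.le_comap_map) hI

omit [IsDedekindDomain R] in
/-- **For a maximal ideal `𝔪 ∌ f` of `R`, the extension `𝔪 R[1/f]` is a maximal ideal of `R[1/f]`**
(its residue ring is the field `R/𝔪`). [cite: AtiyahMacdonald1969, Ch. 3 Prop. 3.11 (iv)] -/
theorem isMaximal_map {𝔪 : Ideal R} [h𝔪 : 𝔪.IsMaximal] (hfm : f ∉ 𝔪) :
    (𝔪.map (algebraMap R R')).IsMaximal := by
  apply Ideal.Quotient.maximal_of_isField
  have hbij := bijective_quotientMap_map R' hfm
  exact MulEquiv.isField ((Ideal.Quotient.maximal_ideal_iff_isField_quotient 𝔪).mp h𝔪)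
    (RingEquiv.ofBijective _ hbij).symm.toMulEquiv

/-- In a Dedekind domain only finitely many maximal ideals contain a given `f ≠ 0` (they are prime
factors of `(f)`). [cite: NeukirchANT1999, Ch. I §3 Thm. (3.3)] -/
theorem finite_setOf_isMaximal_mem (hf : f ≠ 0) :
    {𝔪 : Ideal R | 𝔪.IsMaximal ∧ f ∈ 𝔪}.Finite := by
  have hspan : Ideal.span {f} ≠ ⊥ := by
    rw [Ne, Ideal.span_singleton_eq_bot]
    exact hf
  have hfin := (Ideal.finite_factors hspan).to_subtype
  have hne : ∀ 𝔪 : Ideal R, 𝔪.IsMaximal ∧ f ∈ 𝔪 → 𝔪 ≠ ⊥ := by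
    rintro 𝔪 ⟨-, hfm⟩ rfl
    exact hf ((Submodule.mem_bot R).1 hfm)
  let φ : {𝔪 : Ideal R | 𝔪.IsMaximal ∧ f ∈ 𝔪} →
      {v : IsDedekindDomain.HeightOneSpectrum R | v.asIdeal ∣ Ideal.span {f}} := fun 𝔪 =>
    ⟨⟨𝔪.1, 𝔪.2.1.isPrime, hne 𝔪.1 𝔪.2⟩,
      Ideal.dvd_iff_le.2 ((Ideal.span_singleton_le_iff_mem _).2 𝔪.2.2)⟩
  have hφ : Function.Injective φ := by
    rintro ⟨x, hx⟩ ⟨y, hy⟩ h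
    exact Subtype.ext (congrArg (fun v => v.1.asIdeal) h :)
  haveI : Finite {𝔪 : Ideal R | 𝔪.IsMaximal ∧ f ∈ 𝔪} := Finite.of_injective φ hφ
  exact Set.toFinite _

/-- If a Dedekind domain has infinitely many maximal ideals, then infinitely many of them do not
contain a given `f ≠ 0`. [cite: NeukirchANT1999, Ch. I §3 Thm. (3.3)] -/
theorem infinite_setOf_isMaximal_not_mem (hf : f ≠ 0)
    (hinf : {𝔪 : Ideal R | 𝔪.IsMaximal}.Infinite) :
    {𝔪 : Ideal R | 𝔪.IsMaximal ∧ f ∉ 𝔪}.Infinite := by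
  have hunion : {𝔪 : Ideal R | 𝔪.IsMaximal} =
      {𝔪 : Ideal R | 𝔪.IsMaximal ∧ f ∈ 𝔪} ∪ {𝔪 : Ideal R | 𝔪.IsMaximal ∧ f ∉ 𝔪} := by
    ext 𝔪
    simp only [Set.mem_setOf_eq, Set.mem_union]
    tauto
  rw [hunion, Set.infinite_union] at hinf
  exact hinf.resolve_left (finite_setOf_isMaximal_mem hf).not_infinite

/-- **`R[1/f]` has infinitely many maximal ideals if `R` has** (`R` Dedekind, `f ≠ 0`): the maximal
ideals `𝔪 ∌ f` of `R` — all but finitely many — extend injectively to maximal ideals of `R[1/f]`.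
[cite: AtiyahMacdonald1969, Ch. 3 Prop. 3.11 (iv)] -/
theorem infinite_setOf_isMaximal (hf : f ≠ 0) (hinf : {𝔪 : Ideal R | 𝔪.IsMaximal}.Infinite) :
    {𝔪' : Ideal R' | 𝔪'.IsMaximal}.Infinite := by
  have hS := infinite_setOf_isMaximal_not_mem hf hinf
  have hinj : Set.InjOn (fun 𝔪 : Ideal R => 𝔪.map (algebraMap R R'))
      {𝔪 : Ideal R | 𝔪.IsMaximal ∧ f ∉ 𝔪} := by
    rintro 𝔪 ⟨h𝔪, hfm⟩ 𝔫 ⟨h𝔫, hfn⟩ h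
    have h1 := comap_map_eq R' (h𝔭 := h𝔪.isPrime) hfm
    have h2 := comap_map_eq R' (h𝔭 := h𝔫.isPrime) hfn
    rw [← h1, ← h2]
    exact congrArg (Ideal.comap (algebraMap R R')) h
  refine Set.infinite_of_injOn_mapsTo hinj ?_ hS
  rintro 𝔪 ⟨h𝔪, hfm⟩
  exact isMaximal_map R' (h𝔪 := h𝔪) hfm

/-! ### Conversely: maximal ideals of `R[1/f]` contract to maximal ideals of `R` -/

omit [IsDedekindDomain R] in
include f in
/-- Every ideal of `R[1/f]` is extended from its contraction (Mathlib `IsLocalization.map_under`).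
[cite: AtiyahMacdonald1969, Ch. 3 Prop. 3.11 (i)] -/
theorem map_comap_eq (𝔪' : Ideal R') : (𝔪'.comap (algebraMap R R')).map (algebraMap R R') = 𝔪' :=
  IsLocalization.map_under (Submonoid.powers f) R' 𝔪'

omit [IsDedekindDomain R] in
/-- `f` lies in no proper ideal contracted from `R[1/f]` (it is a unit there).
[cite: AtiyahMacdonald1969, Ch. 3 Prop. 3.11 (ii)] -/
theorem not_mem_comap {𝔪' : Ideal R'} (h : 𝔪' ≠ ⊤) : f ∉ 𝔪'.comap (algebraMap R R') := by
  intro hf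
  apply h
  rw [Ideal.mem_comap] at hf
  exact Ideal.eq_top_of_isUnit_mem _ hf (IsLocalization.Away.algebraMap_isUnit f)

/-- **If `R` has infinitely many maximal ideals, then `R[1/f]` is not a field**: a maximal ideal of
`R[1/f]` is non-zero (otherwise every maximal ideal `𝔪 ∌ f` of `R` would extend to a proper non-zero
ideal of a field). [cite: AtiyahMacdonald1969, Ch. 3 Prop. 3.11 (iv)] -/
theorem ne_bot_of_isMaximal (hf : f ≠ 0) (hinf : {𝔪 : Ideal R | 𝔪.IsMaximal}.Infinite)
    (𝔪' : Ideal R') [h𝔪' : 𝔪'.IsMaximal] : 𝔪' ≠ ⊥ := by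
  intro hbot
  subst hbot
  -- pick two distinct maximal ideals of `R` not containing `f`; their (maximal, distinct) extensions to
  -- `R'` are both `⊤`-or-... : simpler — pick ONE maximal `𝔪 ∌ f`, `𝔪 ≠ ⊥`: its extension is a
  -- non-zero proper ideal, contradicting the maximality of `⊥`.
  obtain ⟨𝔪, ⟨h𝔪, hfm⟩, hne⟩ : ∃ 𝔪 ∈ {𝔪 : Ideal R | 𝔪.IsMaximal ∧ f ∉ 𝔪}, 𝔪 ≠ (⊥ : Ideal R) :=
    ((infinite_setOf_isMaximal_not_mem hf hinf).sdiff (Set.finite_singleton ⊥)).nonempty.imp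
      fun 𝔪 h => ⟨h.1, h.2⟩
  haveI := h𝔪
  have hmax : (𝔪.map (algebraMap R R')).IsMaximal := isMaximal_map R' hfm
  have hnebot : 𝔪.map (algebraMap R R') ≠ ⊥ := by
    intro h
    apply hne
    have := comap_map_eq R' (h𝔭 := h𝔪.isPrime) hfm
    rw [h] at this
    rw [← this, Ideal.comap_bot_of_injective _ (algebraMap_injective R' hf)]
  exact hmax.ne_top (h𝔪'.out.2 _ (bot_lt_iff_ne_bot.2 hnebot))

include f in
/-- **A non-zero maximal ideal of `R[1/f]` contracts to a maximal ideal of `R`** (`R` Dedekind: the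
contraction is a non-zero prime). [cite: AtiyahMacdonald1969, Ch. 3 Prop. 3.11 (iv)] -/
theorem isMaximal_comap (𝔪' : Ideal R') [h𝔪' : 𝔪'.IsMaximal] (hne : 𝔪' ≠ ⊥) :
    (𝔪'.comap (algebraMap R R')).IsMaximal := by
  have hprime : (𝔪'.comap (algebraMap R R')).IsPrime := Ideal.comap_isPrime _ _
  refine hprime.isMaximal ?_
  intro hbot
  apply hne
  rw [← map_comap_eq (f := f) R' 𝔪', hbot, Ideal.map_bot]

include f in
/-- **Residue fields do not change**: for a non-zero maximal ideal `𝔪'` of `R[1/f]`, the residue map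
`R/(𝔪' ∩ R) → R[1/f]/𝔪'` is bijective. [cite: AtiyahMacdonald1969, Ch. 3 Prop. 3.11 (iv)] -/
theorem bijective_quotientMap (𝔪' : Ideal R') [h𝔪' : 𝔪'.IsMaximal] (hne : 𝔪' ≠ ⊥) :
    Function.Bijective
      (Ideal.quotientMap 𝔪' (algebraMap R R') le_rfl : R ⧸ 𝔪'.comap (algebraMap R R') →+* R' ⧸ 𝔪') :=
  ⟨Ideal.quotientMap_injective,
    IsLocalization.surjective_quotientMap_of_maximal_of_localization (Submonoid.powers f) R'
      (H := le_rfl) (isMaximal_comap (f := f) R' 𝔪' hne)⟩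

/-! ### Finiteness of the residue fields over a base field `F` -/

/-- **The residue fields of `R[1/f]` are finite over `F` if those of `R` are.**  Let `F → R` be an
algebra with `R` Dedekind having infinitely many maximal ideals, all of whose residue fields are finite
over `F` (junction J-a: `R` = the integral closure of `F[X]` in a finite separable extension of `F(X)`),
`0 ≠ f ∈ R` and `R' = R[1/f]` (an `F`-algebra compatibly).  Then every residue field `R'/𝔪'` is finite
over `F` — so, for `F` a `p`-adic field, a `p`-adic field.
[cite: MochizukiAbsTopIII2015, Rmk 1.5.4 (i) p.33] -/
theorem moduleFinite_quotient {F : Type w} [CommRing F] [Algebra F R] [Algebra F R']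
    [IsScalarTower F R R'] (hf : f ≠ 0) (hinf : {𝔪 : Ideal R | 𝔪.IsMaximal}.Infinite)
    (hfin : ∀ (𝔪 : Ideal R), 𝔪.IsMaximal → Module.Finite F (R ⧸ 𝔪))
    (𝔪' : Ideal R') [h𝔪' : 𝔪'.IsMaximal] : Module.Finite F (R' ⧸ 𝔪') := by
  have hne : 𝔪' ≠ ⊥ := ne_bot_of_isMaximal R' hf hinf 𝔪'
  haveI : Module.Finite F (R ⧸ 𝔪'.comap (algebraMap R R')) :=
    hfin _ (isMaximal_comap (f := f) R' 𝔪' hne)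
  -- the residue map as an `F`-algebra map
  let φ : (R ⧸ 𝔪'.comap (algebraMap R R')) →ₐ[F] R' ⧸ 𝔪' :=
    Ideal.quotientMapₐ 𝔪' (IsScalarTower.toAlgHom F R R') le_rfl
  have hφ : Function.Surjective φ := fun x => by
    obtain ⟨y, hy⟩ := (bijective_quotientMap (f := f) R' 𝔪' hne).2 x
    exact ⟨y, hy⟩
  exact Module.Finite.of_surjective φ.toLinearMap hφ

omit [IsDedekindDomain R] in
/-- The same for the extension `𝔪 R[1/f]` of a maximal ideal `𝔪 ∌ f` of `R` (no infinitude hypothesis):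
`R[1/f]/𝔪R[1/f]` is finite over `F` if `R/𝔪` is. [cite: MochizukiAbsTopIII2015, Rmk 1.5.4 (i) p.33] -/
theorem moduleFinite_quotient_map {F : Type w} [CommRing F] [Algebra F R] [Algebra F R']
    [IsScalarTower F R R'] {𝔪 : Ideal R} [h𝔪 : 𝔪.IsMaximal] (hfm : f ∉ 𝔪)
    [Module.Finite F (R ⧸ 𝔪)] : Module.Finite F (R' ⧸ 𝔪.map (algebraMap R R')) := by
  let φ : (R ⧸ 𝔪) →ₐ[F] R' ⧸ 𝔪.map (algebraMap R R') :=
    Ideal.quotientMapₐ (𝔪.map (algebraMap R R')) (IsScalarTower.toAlgHom F R R') Ideal.le_comap_map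
  have hφ : Function.Surjective φ := fun x => by
    obtain ⟨y, hy⟩ := (bijective_quotientMap_map R' hfm).2 x
    exact ⟨y, hy⟩
  exact Module.Finite.of_surjective φ.toLinearMap hφ

end IsLocalization.Away

end Literature.AnabelianGeometry.AbsoluteAnabelian.AbsTopIII
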